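import Literature.NumberTheory.Automorphic.UnitaryGroupHeisenbergLatticeCollapse
import Literature.NumberTheory.Automorphic.UnitaryGroupHeisenbergCentreLatticeUnfolding
import HarnessLib

/-!
# The inner `N(F)\N(𝔸_F)`-integral of the Heisenberg part of the unipotent term: its VALUE
# (Rogawski (1990), Prop. 7.3.2, p. 97: `∫_{U∖𝐔} Σ_{x ∈ E^*} Σ_{w ∈ E⁰} f^K(y⁻¹ γ u(x) n(w) y) = Σ_{x ∈ E^*} ψ(x)`-step)

Topic `NumberTheory/Automorphic`; namespace `Literature.NumberTheory.Automorphic.UnitaryGroup`. THEOREMS ONLY over accepted tree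
modules (no definition, no named fact, no instance, no notation, no `sorry`). Row (E-N) FILE 2 of the Heisenberg part (E) of the
unipotent term `P_{z·𝒰}` (LAW 5 road of `Cruxes/H413/Lines/F0_T1InnerFormTraceIdentity.lean`, crux H413; cell hodgecm-mathlib),
composing ★ (E-N) FILE 1 `UnitaryGroupHeisenbergLatticeCollapse` (collapse over the chart box, uniform finiteness, tail invariance)
with ★ (E1b) `UnitaryGroupHeisenbergCentreLatticeUnfolding` (B-p10 (g19): `setIntegral_tsum_comp_commShift_eq`, the `x₀`-twist +
lattice unfolding `∫_{D_E} Σ'_w g(w + L_ξ x) dμX = (μX(D_E)/μY(𝓕⁻)) ∫ g dμY`).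

Letters: `u(ξ, w) := heisChart hc (algebraMap E 𝔸_E ξ, w)`; `z₁ ∈ G(F)` with `↑z₁ = toAdelic (ratCenter ζ)` (central); the
Heisenberg piece of the class sum at `g` is `Σ'_{ξ ∈ E^×} Σ'_{w ∈ E⁻} f(g⁻¹ (z₁ u(ξ, w)) g)` (★ (E0) `tsum_rationalUnipotent_ne_one_eq_add`, second
summand, currency pin of the (F) assembly `UnitaryGroupUnipotentTruncatedTracePolynomial`); `Ω_N := heisHomeomorph hc '' (D_E ×ˢ 𝓕⁻)` with
`D_E = adeleFundamentalDomain E`, `𝓕⁻ = traceZeroFundamentalDomain F E c`, `μN := heisHaar hc μX μY`.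

* §1 `inv_mul_mul_conj_eq` — `(n y)⁻¹ (z₁ v) (n y) = y⁻¹ (z₁ (n⁻¹ v n)) y` (centrality); `hasCompactSupport_conjKernel`, `continuous_conjKernel`
  for `φ_y(v) := f(y⁻¹ (z₁ v) y)`.
* §2 `integrable_heisFibre` — `y' ↦ φ_y(u(ξ, y'))` is continuous with compact support on `𝔸_E⁻`, hence `μY`-integrable;
  `integrableOn_tsum_heisFibre_commShift` — `x ↦ Σ'_w φ_y(u(ξ, w + L_ξ x))` is integrable on `D_E` (a finite sum of continuous functions there).
* §3 **`integrableOn_and_setIntegral_heisHaar_heisPart_eq`** — for every `y ∈ G(𝔸_F)`: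
  `∫ n in Ω_N, Σ'_ξ Σ'_w f((n y)⁻¹ (z₁ u(ξ, w)) (n y)) ∂heisHaar = μX(D_E) · Σ'_{ξ ≠ 0} ∫_{𝔸⁻} f(y⁻¹ (z₁ u(ξ, y')) y) dμY(y')`, and the integrand
  is integrable on `Ω_N`; §4 `setIntegral_heisHaar_kernelBorelTailClass_eq` — the tail's `Ω_N`-integral `= (μX D_E · μY 𝓕⁻) · tail_T(y)`, and
  **`integrableOn_and_setIntegral_heisHaar_heisBracket_eq`** — the two combined: the inner integral of `ψʳ_T(n y)` (no torus structure of `y`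
  is used; the (E) assembly specialises `y := t k`).

## References
* J. D. Rogawski, *Automorphic Representations of Unitary Groups in Three Variables*, Ann. of Math. Stud. 123 (1990), §7.3 Prop. 7.3.2
  (pp. 96–97), §2.2 (p. 13) [Rogawski1990].
* J. W. S. Cassels, A. Fröhlich (eds.), *Algebraic Number Theory* (1967), Ch. XV (Tate), Thm. 4.1.3 [CasselsFrohlichANT1967].
-/

set_option autoImplicit false

noncomputable section

open Matrix NumberField IsDedekindDomain Topology MeasureTheory Measure Set Polynomial
open scoped MatrixGroups ENNReal NNReal Pointwise

namespace Literature.NumberTheory.Automorphic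

namespace UnitaryGroup

variable {F E : Type} [Field F] [NumberField F] [Field E] [NumberField E] [Algebra F E]
  {c : E ≃ₐ[F] E} {ι : Type*}

/-! ## §1 The conjugated kernel `φ_y(v) = f(y⁻¹ (z₁ v) y)` -/

section Kernel

variable (ζ : ratOne F E c) {z₁ : (quasiSplit F E c 3).arithmeticSubgroup}

/-- **`(n y)⁻¹ (z₁ v) (n y) = y⁻¹ (z₁ (n⁻¹ v n)) y`** (`z₁` central, ★ `toAdelic_ratCenter_mul_comm`). [cite: Rogawski1990, §7.3 (p. 97)] -/
theorem inv_mul_mul_conj_eq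
    (hz₁ : (z₁ : (quasiSplit F E c 3).Adelic) =
      (quasiSplit F E c 3).toAdelic (ratCenter F E c 3 ((StdForm.antidiagonal 3).over E) ζ))
    (n y v : (quasiSplit F E c 3).Adelic) :
    (n * y)⁻¹ * ((z₁ : (quasiSplit F E c 3).Adelic) * v) * (n * y) =
      y⁻¹ * ((z₁ : (quasiSplit F E c 3).Adelic) * (n⁻¹ * v * n)) * y := by
  have hz : (z₁ : (quasiSplit F E c 3).Adelic) * n⁻¹ = n⁻¹ * (z₁ : (quasiSplit F E c 3).Adelic) := by
    rw [hz₁]; exact toAdelic_ratCenter_mul_comm ζ n⁻¹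
  rw [_root_.mul_inv_rev]
  simp only [mul_assoc]
  rw [← mul_assoc n⁻¹ (z₁ : (quasiSplit F E c 3).Adelic), ← hz, mul_assoc]

/-- The conjugated kernel `v ↦ f(y⁻¹ (z₁ v) y)` is continuous. [cite: Rogawski1990, §7.3 (p. 97)] -/
theorem continuous_conjKernel {M : Type*} [TopologicalSpace M] {f : (quasiSplit F E c 3).Adelic → M} (hfc : Continuous f)
    (z y : (quasiSplit F E c 3).Adelic) : Continuous fun v : (quasiSplit F E c 3).Adelic => f (y⁻¹ * (z * v) * y) :=
  hfc.comp (((continuous_const.mul continuous_id).const_mul _).mul continuous_const)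

/-- The conjugated kernel `v ↦ f(y⁻¹ (z v) y)` has compact support if `f` has (it is `f` along a homeomorphism of `G(𝔸_F)`).
[cite: Rogawski1990, §7.3 (p. 97)] -/
theorem hasCompactSupport_conjKernel {M : Type*} [TopologicalSpace M] [Zero M] {f : (quasiSplit F E c 3).Adelic → M}
    (hf : HasCompactSupport f) (z y : (quasiSplit F E c 3).Adelic) :
    HasCompactSupport fun v : (quasiSplit F E c 3).Adelic => f (y⁻¹ * (z * v) * y) := by
  have h := hf.comp_homeomorph ((Homeomorph.mulLeft (y⁻¹ * z)).trans (Homeomorph.mulRight y))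
  convert h using 1
  funext v
  simp only [Function.comp_apply, Homeomorph.trans_apply, Homeomorph.coe_mulLeft, Homeomorph.coe_mulRight, mul_assoc]

end Kernel

/-! ## §2 Integrability of the fibres -/

section Fibre

/-- `N(𝔸_F)` is closed in `G(𝔸_F)` (local copy of the standard argument). [folklore] -/
private theorem isClosed_adelicUnipotent₃ : IsClosed ((adelicUnipotent F E c 3 : Set (quasiSplit F E c 3).Adelic)) := by
  haveI : T2Space (AdeleRing (𝓞 E) E) := t2Space_adeleRing_of_numberField E
  change IsClosed (⇑(adelicVal F E c 3 ((StdForm.antidiagonal 3).over E)) ⁻¹'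
    ((upperUnitriangular (Fin 3) (AdeleRing (𝓞 E) E) : Subgroup (GL (Fin 3) (AdeleRing (𝓞 E) E))) :
      Set (GL (Fin 3) (AdeleRing (𝓞 E) E))))
  exact (isClosed_upperUnitriangular (R := AdeleRing (𝓞 E) E)).preimage continuous_subtype_val

/-- **The fibre `y' ↦ φ(u(x₀, y'))` of a compactly supported `φ` has compact support on `𝔸_E⁻`** (the chart is a homeomorphism onto the
closed `N(𝔸_F)`). [cite: Rogawski1990, §7.3 (p. 97)] -/
theorem hasCompactSupport_heisFibre {M : Type*} [TopologicalSpace M] [Zero M] (hc : c * c = 1)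
    {φ : (quasiSplit F E c 3).Adelic → M} (hφ : HasCompactSupport φ) (x₀ : AdeleRing (𝓞 E) E) :
    HasCompactSupport fun y' : traceZeroAdele F E c =>
      φ (((heisChart hc (x₀, y')) : adelicUnipotent F E c 3) : (quasiSplit F E c 3).Adelic) := by
  haveI : T2Space (AdeleRing (𝓞 E) E) := t2Space_adeleRing_of_numberField E
  haveI : T2Space (quasiSplit F E c 3).Adelic :=
    inferInstanceAs (T2Space (adelic F E c 3 ((StdForm.antidiagonal 3).over E)))
  -- the compact set of `y'` with `u(x₀, y')` in the topological support of `φ`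
  have hK : IsCompact ((Subtype.val : adelicUnipotent F E c 3 → (quasiSplit F E c 3).Adelic) ⁻¹' tsupport φ) :=
    (isClosed_adelicUnipotent₃ (F := F) (E := E) (c := c)).isClosedEmbedding_subtypeVal.isCompact_preimage hφ
  have hK' : IsCompact (Prod.snd '' ((heisChart hc).symm ''
      ((Subtype.val : adelicUnipotent F E c 3 → (quasiSplit F E c 3).Adelic) ⁻¹' tsupport φ))) :=
    (hK.image (heisChart hc).symm.continuous).image continuous_snd
  refine HasCompactSupport.intro hK' fun y' hy' => ?_
  by_contra hne
  apply hy'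
  refine ⟨(x₀, y'), ⟨heisChart hc (x₀, y'), subset_tsupport _ hne, Homeomorph.symm_apply_apply _ _⟩, rfl⟩

/-- The fibre `y' ↦ φ(u(x₀, y'))` of a continuous `φ` is continuous. [cite: Rogawski1990, §7.3 (p. 97)] -/
theorem continuous_heisFibre {M : Type*} [TopologicalSpace M] (hc : c * c = 1)
    {φ : (quasiSplit F E c 3).Adelic → M} (hφc : Continuous φ) (x₀ : AdeleRing (𝓞 E) E) :
    Continuous fun y' : traceZeroAdele F E c =>
      φ (((heisChart hc (x₀, y')) : adelicUnipotent F E c 3) : (quasiSplit F E c 3).Adelic) :=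
  hφc.comp (continuous_subtype_val.comp ((heisChart hc).continuous.comp (continuous_const.prodMk continuous_id)))

variable [MeasurableSpace (AdeleRing (𝓞 E) E)] [BorelSpace (AdeleRing (𝓞 E) E)]

/-- **The fibre `y' ↦ φ(u(x₀, y'))` is `μY`-integrable** for `φ ∈ C_c(G(𝔸_F))` and every Radon `μY` on `𝔸_E⁻` — the hypothesis `hg` of ★
`setIntegral_tsum_comp_commShift_eq`. [cite: Rogawski1990, §7.3 (p. 97)] -/
theorem integrable_heisFibre {V : Type*} [NormedAddCommGroup V] (hc : c * c = 1)
    {φ : (quasiSplit F E c 3).Adelic → V} (hφc : Continuous φ) (hφ : HasCompactSupport φ)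
    (μY : Measure (traceZeroAdele F E c)) [IsFiniteMeasureOnCompacts μY] (x₀ : AdeleRing (𝓞 E) E) :
    Integrable (fun y' : traceZeroAdele F E c =>
      φ (((heisChart hc (x₀, y')) : adelicUnipotent F E c 3) : (quasiSplit F E c 3).Adelic)) μY :=
  (continuous_heisFibre hc hφc x₀).integrable_of_hasCompactSupport (hasCompactSupport_heisFibre hc hφ x₀)

/-- **On `D_E` the `w`-sum `x ↦ Σ'_{w ∈ E⁻} φ(u(ξ, w + L_ξ(x)))` (`ξ ≠ 0`) is integrable** (`φ ∈ C_c`): off a uniform finite set of `w` the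
terms vanish for `x ∈ D_E` (★ FILE 1 `finite_setOf_heis_exists_conj_mem_of_isCompact`, `u(ξ, w + L_ξ x) = u(x,0)⁻¹ u(ξ,w) u(x,0)` ★ (E1a)
`coe_inv_mul_heisChart_mul`), so on `D_E` the sum is a FINITE sum of continuous functions, integrable on the compact `closure D_E`.
[cite: Rogawski1990, §7.3 (p. 97)] -/
theorem integrableOn_tsum_heisFibre_commShift {V : Type*} [NormedAddCommGroup V] [NormedSpace ℝ V] [CompleteSpace V] (hc : c * c = 1)
    {φ : (quasiSplit F E c 3).Adelic → V} (hφc : Continuous φ) (hφ : HasCompactSupport φ)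
    (μX : Measure (AdeleRing (𝓞 E) E)) [IsFiniteMeasureOnCompacts μX] (ξ : {ξ : E // ξ ≠ 0}) :
    IntegrableOn (fun x : AdeleRing (𝓞 E) E => ∑' w : rationalTraceZero F E c,
      φ (((heisChart hc (algebraMap E (AdeleRing (𝓞 E) E) (ξ : E), (w : traceZeroAdele F E c) +
        ⟨x * conjAdele F E c (algebraMap E (AdeleRing (𝓞 E) E) (ξ : E)) - algebraMap E (AdeleRing (𝓞 E) E) (ξ : E) * conjAdele F E c x,
          commShift_mem_traceZeroAdele hc _ x⟩)) : adelicUnipotent F E c 3) : (quasiSplit F E c 3).Adelic))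
      (adeleFundamentalDomain E) μX := by
  classical
  haveI : T2Space (AdeleRing (𝓞 E) E) := t2Space_adeleRing_of_numberField E
  -- the compact set of conjugators `u(x, 0)`, `x ∈ closure D_E`, and the finite set of contributing `w`
  have hC : IsCompact ((fun x : AdeleRing (𝓞 E) E =>
      (((heisChart hc (x, (0 : traceZeroAdele F E c))) : adelicUnipotent F E c 3) : (quasiSplit F E c 3).Adelic)) ''
        closure (adeleFundamentalDomain E)) :=
    (isCompact_closure_adeleFundamentalDomain (K := E)).image
      ((continuous_subtype_val.comp ((heisChart hc).continuous.comp (continuous_id.prodMk continuous_const))))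
  have hfin := finite_setOf_heis_exists_conj_mem_of_isCompact (F := F) (E := E) (c := c) hc hC hφ.isCompact
  -- the term function and its continuity in `x`
  set term : rationalTraceZero F E c → AdeleRing (𝓞 E) E → V := fun w x =>
    φ (((heisChart hc (algebraMap E (AdeleRing (𝓞 E) E) (ξ : E), (w : traceZeroAdele F E c) +
      ⟨x * conjAdele F E c (algebraMap E (AdeleRing (𝓞 E) E) (ξ : E)) - algebraMap E (AdeleRing (𝓞 E) E) (ξ : E) * conjAdele F E c x,
        commShift_mem_traceZeroAdele hc _ x⟩)) : adelicUnipotent F E c 3) : (quasiSplit F E c 3).Adelic) with htermdef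
  have hterm : ∀ w, Continuous (term w) := by
    intro w
    have hL : Continuous fun x : AdeleRing (𝓞 E) E =>
        (⟨x * conjAdele F E c (algebraMap E (AdeleRing (𝓞 E) E) (ξ : E)) -
            algebraMap E (AdeleRing (𝓞 E) E) (ξ : E) * conjAdele F E c x,
          commShift_mem_traceZeroAdele hc _ x⟩ : traceZeroAdele F E c) :=
      ((continuous_id.mul continuous_const).sub (continuous_const.mul (continuous_conjAdele F E c))).subtype_mk _
    exact hφc.comp (continuous_subtype_val.comp ((heisChart hc).continuous.comp
      (continuous_const.prodMk (continuous_const.add hL))))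
  -- off the finite set `W` the terms vanish on `D_E`
  have hzero : ∀ x ∈ adeleFundamentalDomain E, ∀ w : rationalTraceZero F E c, w ∉ hfin.toFinset.image Prod.snd → term w x = 0 := by
    intro x hx w hw
    by_contra hne
    apply hw
    rw [Finset.mem_image]
    refine ⟨(ξ, w), hfin.mem_toFinset.2 ⟨_, ⟨x, subset_closure hx, rfl⟩, ?_⟩, rfl⟩
    have h := coe_inv_mul_heisChart_mul hc (heisChart hc (x, (0 : traceZeroAdele F E c)))
      (algebraMap E (AdeleRing (𝓞 E) E) (ξ : E)) (w : traceZeroAdele F E c)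
    simp only [coordX_heisChart] at h
    rw [h]
    exact subset_tsupport _ hne
  -- on `D_E` the `tsum` is the finite sum, a continuous function
  have hEq : EqOn (fun x => ∑ w ∈ hfin.toFinset.image Prod.snd, term w x) (fun x => ∑' w, term w x)
      (adeleFundamentalDomain E) := fun x hx => (tsum_eq_sum fun w hw => hzero x hx w hw).symm
  have hcont : Continuous fun x => ∑ w ∈ hfin.toFinset.image Prod.snd, term w x :=
    continuous_finsetSum _ fun w _ => hterm w
  have hint : IntegrableOn (fun x => ∑ w ∈ hfin.toFinset.image Prod.snd, term w x) (adeleFundamentalDomain E) μX :=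
    (hcont.continuousOn.integrableOn_compact (isCompact_closure_adeleFundamentalDomain (K := E))).mono_set subset_closure
  exact hint.congr_fun hEq (measurableSet_adeleFundamentalDomain E)

end Fibre

/-! ## §3 The value of the `Ω_N`-integral of the Heisenberg piece -/

section Value

variable (ζ : ratOne F E c) {z₁ : (quasiSplit F E c 3).arithmeticSubgroup}
  [LocallyCompactSpace (AdeleRing (𝓞 E) E)]
  [MeasurableSpace (AdeleRing (𝓞 E) E)] [BorelSpace (AdeleRing (𝓞 E) E)]
  [MeasurableSpace (unipotentInBorel F E c 3)] [BorelSpace (unipotentInBorel F E c 3)]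
  (hc : c * c = 1)
  (μX : Measure (AdeleRing (𝓞 E) E)) [μX.IsAddHaarMeasure]
  (μY : Measure (traceZeroAdele F E c)) [μY.IsAddHaarMeasure]

/-- **THE `Ω_N`-INTEGRAL OF THE HEISENBERG PIECE** (Rogawski, p. 97: integrating `Σ_{x ∈ E^*} Σ_{w ∈ E⁰} f^K(y⁻¹ γ u(x) n(w) y)` over
`U(F)∖U(𝔸)` gives `Σ_{x ∈ E^*} ψ(x)` with `ψ(x) = ∫_{𝔸⁻} …`): for every `y ∈ G(𝔸_F)` and `f ∈ C_c(G(𝔸_F))`, with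
`Ω_N = heisHomeomorph(D_E × 𝓕⁻)`, `μN = heisHaar`:

  `∫_{n ∈ Ω_N} Σ'_{ξ ∈ E^×} Σ'_{w ∈ E⁻} f((n y)⁻¹ (z₁ u(ξ, w)) (n y)) dμN = μX(D_E) · Σ'_{ξ ∈ E^×} ∫_{𝔸_E⁻} f(y⁻¹ (z₁ u(ξ, y')) y) dμY(y')`,

and the integrand is integrable on `Ω_N` (★ FILE 1 collapse + finite `ξ`-support + ★ (E1b) `setIntegral_tsum_comp_commShift_eq` fibrewise).
[cite: Rogawski1990, §7.3 Prop. 7.3.2 (p. 97)] [cite: CasselsFrohlichANT1967, Ch. XV Thm. 4.1.3] -/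
theorem integrableOn_and_setIntegral_heisHaar_heisPart_eq (hc1 : c ≠ 1)
    (hz₁ : (z₁ : (quasiSplit F E c 3).Adelic) =
      (quasiSplit F E c 3).toAdelic (ratCenter F E c 3 ((StdForm.antidiagonal 3).over E) ζ))
    {f : (quasiSplit F E c 3).Adelic → ℂ} (hfc : Continuous f) (hf : HasCompactSupport f) (y : (quasiSplit F E c 3).Adelic) :
    IntegrableOn (fun n : unipotentInBorel F E c 3 =>
        ∑' ξ : {ξ : E // ξ ≠ 0}, ∑' w : rationalTraceZero F E c,
          f ((((n : borelAdelic F E c 3) : (quasiSplit F E c 3).Adelic) * y)⁻¹ *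
            ((z₁ : (quasiSplit F E c 3).Adelic) *
              (((heisChart hc (algebraMap E (AdeleRing (𝓞 E) E) (ξ : E), (w : traceZeroAdele F E c))) :
                adelicUnipotent F E c 3) : (quasiSplit F E c 3).Adelic)) *
            (((n : borelAdelic F E c 3) : (quasiSplit F E c 3).Adelic) * y)))
      (heisHomeomorph hc '' (adeleFundamentalDomain E ×ˢ traceZeroFundamentalDomain F E c)) (heisHaar hc μX μY) ∧
    ∫ n in heisHomeomorph hc '' (adeleFundamentalDomain E ×ˢ traceZeroFundamentalDomain F E c),
        (∑' ξ : {ξ : E // ξ ≠ 0}, ∑' w : rationalTraceZero F E c,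
          f ((((n : borelAdelic F E c 3) : (quasiSplit F E c 3).Adelic) * y)⁻¹ *
            ((z₁ : (quasiSplit F E c 3).Adelic) *
              (((heisChart hc (algebraMap E (AdeleRing (𝓞 E) E) (ξ : E), (w : traceZeroAdele F E c))) :
                adelicUnipotent F E c 3) : (quasiSplit F E c 3).Adelic)) *
            (((n : borelAdelic F E c 3) : (quasiSplit F E c 3).Adelic) * y))) ∂(heisHaar hc μX μY) =
      ((μX.real (adeleFundamentalDomain E) : ℝ) : ℂ) *
        ∑' ξ : {ξ : E // ξ ≠ 0}, ∫ y' : traceZeroAdele F E c,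
          f (y⁻¹ * ((z₁ : (quasiSplit F E c 3).Adelic) *
            (((heisChart hc (algebraMap E (AdeleRing (𝓞 E) E) (ξ : E), y')) : adelicUnipotent F E c 3) :
              (quasiSplit F E c 3).Adelic)) * y) ∂μY := by
  classical
  haveI : T2Space (AdeleRing (𝓞 E) E) := t2Space_adeleRing_of_numberField E
  haveI := secondCountableTopology_adeleRing E
  haveI := locallyCompactSpace_traceZeroAdele (F := F) (E := E) (c := c)
  haveI : SecondCountableTopology (traceZeroAdele F E c) := TopologicalSpace.Subtype.secondCountableTopology _
  haveI : Countable (rationalTraceZero F E c) := countable_rationalTraceZero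
  -- the conjugated kernel `φ_y`
  set φ : (quasiSplit F E c 3).Adelic → ℂ := fun v => f (y⁻¹ * ((z₁ : (quasiSplit F E c 3).Adelic) * v) * y) with hφdef
  have hφc : Continuous φ := continuous_conjKernel hfc _ y
  have hφs : HasCompactSupport φ := hasCompactSupport_conjKernel hf _ y
  -- names for the fibre functions
  set Fx : {ξ : E // ξ ≠ 0} → AdeleRing (𝓞 E) E → ℂ := fun ξ x => ∑' w : rationalTraceZero F E c,
    φ (((heisChart hc (algebraMap E (AdeleRing (𝓞 E) E) (ξ : E), (w : traceZeroAdele F E c) +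
      ⟨x * conjAdele F E c (algebraMap E (AdeleRing (𝓞 E) E) (ξ : E)) - algebraMap E (AdeleRing (𝓞 E) E) (ξ : E) * conjAdele F E c x,
        commShift_mem_traceZeroAdele hc _ x⟩)) : adelicUnipotent F E c 3) : (quasiSplit F E c 3).Adelic) with hFxdef
  set G : AdeleRing (𝓞 E) E → ℂ := fun x => ∑' ξ : {ξ : E // ξ ≠ 0}, Fx ξ x with hGdef
  -- Step 1: the integrand is `G (heisX n)`
  have hpt : ∀ n : unipotentInBorel F E c 3,
      (∑' ξ : {ξ : E // ξ ≠ 0}, ∑' w : rationalTraceZero F E c,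
        f ((((n : borelAdelic F E c 3) : (quasiSplit F E c 3).Adelic) * y)⁻¹ *
          ((z₁ : (quasiSplit F E c 3).Adelic) *
            (((heisChart hc (algebraMap E (AdeleRing (𝓞 E) E) (ξ : E), (w : traceZeroAdele F E c))) :
              adelicUnipotent F E c 3) : (quasiSplit F E c 3).Adelic)) *
          (((n : borelAdelic F E c 3) : (quasiSplit F E c 3).Adelic) * y))) = G (heisX n) := by
    intro n
    rw [hGdef]
    simp only [hFxdef]
    rw [← tsum_tsum_conj_heisChart_eq hc φ n]
    refine tsum_congr fun ξ => tsum_congr fun w => ?_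
    simp only [hφdef]
    rw [inv_mul_mul_conj_eq ζ hz₁]
  -- Step 2: finite `ξ`-support on `D_E` and integrability of the fibres
  obtain ⟨S, hS⟩ := exists_finset_forall_heisChart_add_commShift_eq_zero (F := F) (E := E) (c := c) hc hφs
    (isCompact_closure_adeleFundamentalDomain (K := E))
  have hSF : ∀ x ∈ adeleFundamentalDomain E, ∀ ξ : {ξ : E // ξ ≠ 0}, ξ ∉ S → Fx ξ x = 0 := by
    intro x hx ξ hξ
    simp only [hFxdef, hS x hx ξ hξ, tsum_zero]
  have hint' : ∀ ξ ∈ S, IntegrableOn (Fx ξ) (adeleFundamentalDomain E) μX := fun ξ _ =>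
    integrableOn_tsum_heisFibre_commShift hc hφc hφs μX ξ
  obtain ⟨h4a, h4b⟩ := setIntegral_tsum_eq_sum_setIntegral_of_forall_not_mem μX (measurableSet_adeleFundamentalDomain E) hSF hint'
  -- `G` is integrable on `D_E` (a finite sum there)
  have hGint : IntegrableOn G (adeleFundamentalDomain E) μX := by
    have hEq : EqOn (fun x => ∑ ξ ∈ S, Fx ξ x) G (adeleFundamentalDomain E) := fun x hx =>
      (tsum_eq_sum fun ξ hξ => hSF x hx ξ hξ).symm
    exact IntegrableOn.congr_fun (integrable_finsetSum S fun ξ hξ => hint' ξ hξ) hEq (measurableSet_adeleFundamentalDomain E)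
  -- measures of the box factors are finite
  have hY : μY (traceZeroFundamentalDomain F E c) < ⊤ := measure_traceZeroFundamentalDomain_lt_top hc μY
  have hYne0 : μY.real (traceZeroFundamentalDomain F E c) ≠ 0 := by
    rw [measureReal_def, ENNReal.toReal_ne_zero]
    exact ⟨(isAddFundamentalDomain_traceZeroFundamentalDomain hc μY).measure_ne_zero (NeZero.ne μY), hY.ne⟩
  refine ⟨?_, ?_⟩
  · -- integrability on `Ω_N`: through the chart, `(x, y') ↦ G x` on `D_E × 𝓕⁻`
    rw [IntegrableOn, heisHaar_restrict_image_prod hc μX μY]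
    have hfun : (fun n : unipotentInBorel F E c 3 =>
        (∑' ξ : {ξ : E // ξ ≠ 0}, ∑' w : rationalTraceZero F E c,
          f ((((n : borelAdelic F E c 3) : (quasiSplit F E c 3).Adelic) * y)⁻¹ *
            ((z₁ : (quasiSplit F E c 3).Adelic) *
              (((heisChart hc (algebraMap E (AdeleRing (𝓞 E) E) (ξ : E), (w : traceZeroAdele F E c))) :
                adelicUnipotent F E c 3) : (quasiSplit F E c 3).Adelic)) *
            (((n : borelAdelic F E c 3) : (quasiSplit F E c 3).Adelic) * y)))) = fun n => G (heisX n) :=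
      funext hpt
    rw [hfun]
    haveI : IsFiniteMeasure (μY.restrict (traceZeroFundamentalDomain F E c)) := isFiniteMeasure_restrict.2 hY.ne
    have hprod : Integrable (fun p : AdeleRing (𝓞 E) E × traceZeroAdele F E c => G p.1)
        ((μX.restrict (adeleFundamentalDomain E)).prod (μY.restrict (traceZeroFundamentalDomain F E c))) :=
      hGint.comp_fst _
    rw [show Measure.map (heisHomeomorph hc) ((μX.restrict (adeleFundamentalDomain E)).prod
        (μY.restrict (traceZeroFundamentalDomain F E c))) =
      Measure.map (heisHomeomorph hc).toMeasurableEquiv ((μX.restrict (adeleFundamentalDomain E)).prod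
        (μY.restrict (traceZeroFundamentalDomain F E c))) from rfl, integrable_map_equiv]
    refine hprod.congr (ae_of_all _ fun p => ?_)
    simp only [Function.comp_apply, Homeomorph.toMeasurableEquiv_coe, heisHomeomorph_apply, heisX_heisElt]
  · -- the value
    calc ∫ n in heisHomeomorph hc '' (adeleFundamentalDomain E ×ˢ traceZeroFundamentalDomain F E c),
          (∑' ξ : {ξ : E // ξ ≠ 0}, ∑' w : rationalTraceZero F E c,
            f ((((n : borelAdelic F E c 3) : (quasiSplit F E c 3).Adelic) * y)⁻¹ *
              ((z₁ : (quasiSplit F E c 3).Adelic) *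
                (((heisChart hc (algebraMap E (AdeleRing (𝓞 E) E) (ξ : E), (w : traceZeroAdele F E c))) :
                  adelicUnipotent F E c 3) : (quasiSplit F E c 3).Adelic)) *
              (((n : borelAdelic F E c 3) : (quasiSplit F E c 3).Adelic) * y))) ∂(heisHaar hc μX μY)
        = ∫ n in heisHomeomorph hc '' (adeleFundamentalDomain E ×ˢ traceZeroFundamentalDomain F E c),
            G (heisX n) ∂(heisHaar hc μX μY) := integral_congr_ae (ae_of_all _ hpt)
      _ = μY.real (traceZeroFundamentalDomain F E c) • ∫ x in adeleFundamentalDomain E, G x ∂μX :=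
          setIntegral_heisHaar_image_prod_comp_heisX hc μX μY _ _ G
      _ = μY.real (traceZeroFundamentalDomain F E c) • ∑ ξ ∈ S, ∫ x in adeleFundamentalDomain E, Fx ξ x ∂μX := by
          rw [hGdef, h4a]
      _ = μY.real (traceZeroFundamentalDomain F E c) • ∑ ξ ∈ S,
            (((μX.real (adeleFundamentalDomain E) / μY.real (traceZeroFundamentalDomain F E c) : ℝ) : ℂ) *
              ∫ y' : traceZeroAdele F E c, φ (((heisChart hc (algebraMap E (AdeleRing (𝓞 E) E) (ξ : E), y')) :
                adelicUnipotent F E c 3) : (quasiSplit F E c 3).Adelic) ∂μY) := by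
          congr 1
          refine Finset.sum_congr rfl fun ξ _ => ?_
          simp only [hFxdef]
          exact setIntegral_tsum_comp_commShift_eq hc hc1 μX μY ξ.2
            (g := fun y' : traceZeroAdele F E c => φ (((heisChart hc (algebraMap E (AdeleRing (𝓞 E) E) (ξ : E), y')) :
              adelicUnipotent F E c 3) : (quasiSplit F E c 3).Adelic))
            (integrable_heisFibre hc hφc hφs μY (algebraMap E (AdeleRing (𝓞 E) E) (ξ : E)))
      _ = ((μX.real (adeleFundamentalDomain E) : ℝ) : ℂ) * ∑ ξ ∈ S,
            ∫ y' : traceZeroAdele F E c, φ (((heisChart hc (algebraMap E (AdeleRing (𝓞 E) E) (ξ : E), y')) :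
              adelicUnipotent F E c 3) : (quasiSplit F E c 3).Adelic) ∂μY := by
          rw [← Finset.mul_sum, Complex.real_smul, ← mul_assoc]
          congr 1
          rw [Complex.ofReal_div, mul_div_cancel₀]
          exact_mod_cast hYne0
      _ = ((μX.real (adeleFundamentalDomain E) : ℝ) : ℂ) * ∑' ξ : {ξ : E // ξ ≠ 0},
            ∫ y' : traceZeroAdele F E c, φ (((heisChart hc (algebraMap E (AdeleRing (𝓞 E) E) (ξ : E), y')) :
              adelicUnipotent F E c 3) : (quasiSplit F E c 3).Adelic) ∂μY := by
          congr 1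
          refine (tsum_eq_sum fun ξ hξ => ?_).symm
          -- off `S` the whole fibre integral vanishes: its periodisation over `E⁻` vanishes on `D_E`
          have h0 : ∫ x in adeleFundamentalDomain E, Fx ξ x ∂μX = 0 :=
            setIntegral_eq_zero_of_forall_eq_zero fun x hx => hSF x hx ξ hξ
          simp only [hFxdef] at h0
          rw [setIntegral_tsum_comp_commShift_eq hc hc1 μX μY ξ.2
            (g := fun y' : traceZeroAdele F E c => φ (((heisChart hc (algebraMap E (AdeleRing (𝓞 E) E) (ξ : E), y')) :
              adelicUnipotent F E c 3) : (quasiSplit F E c 3).Adelic))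
            (integrable_heisFibre hc hφc hφs μY (algebraMap E (AdeleRing (𝓞 E) E) (ξ : E)))] at h0
          rcases mul_eq_zero.1 h0 with h | h
          · exfalso
            have hXne0 : μX.real (adeleFundamentalDomain E) ≠ 0 := by
              rw [measureReal_def, ENNReal.toReal_ne_zero]
              refine ⟨?_, ?_⟩
              · haveI : Countable (AdeleRing.principalSubgroup (𝓞 E) E) := countable_principalSubgroup E
                exact (isAddFundamentalDomain_adeleFundamentalDomain (K := E) μX).measure_ne_zero (NeZero.ne μX)
              · exact ((measure_mono subset_closure).trans_lt
                  (isCompact_closure_adeleFundamentalDomain (K := E)).measure_lt_top).ne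
            apply hXne0
            have h' : (μX.real (adeleFundamentalDomain E) / μY.real (traceZeroFundamentalDomain F E c) : ℝ) = 0 := by
              exact_mod_cast h
            rcases div_eq_zero_iff.1 h' with h'' | h''
            · exact h''
            · exact absurd h'' hYne0
          · exact h
      _ = _ := by simp only [hφdef]

end Value

/-! ## §4 The tail and the whole Heisenberg bracket `ψʳ_T` -/

section Bracket

variable (ζ : ratOne F E c) {z₁ : (quasiSplit F E c 3).arithmeticSubgroup}
  [LocallyCompactSpace (AdeleRing (𝓞 E) E)]
  [MeasurableSpace (AdeleRing (𝓞 E) E)] [BorelSpace (AdeleRing (𝓞 E) E)]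
  [MeasurableSpace (unipotentInBorel F E c 3)] [BorelSpace (unipotentInBorel F E c 3)]
  [MeasurableSpace (adelicUnipotent F E c 3)] [BorelSpace (adelicUnipotent F E c 3)]
  (hc : c * c = 1)
  (μX : Measure (AdeleRing (𝓞 E) E)) [μX.IsAddHaarMeasure]
  (μY : Measure (traceZeroAdele F E c)) [μY.IsAddHaarMeasure]

omit [MeasurableSpace (adelicUnipotent F E c 3)] [BorelSpace (adelicUnipotent F E c 3)] in
/-- `heisHaar(Ω_N) = μX(D_E) · μY(𝓕⁻) < ∞`. [cite: Rogawski1990, §2.1] -/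
theorem heisHaar_image_fundamentalDomain_lt_top :
    heisHaar hc μX μY (heisHomeomorph hc '' (adeleFundamentalDomain E ×ˢ traceZeroFundamentalDomain F E c)) < ⊤ := by
  haveI : T2Space (AdeleRing (𝓞 E) E) := t2Space_adeleRing_of_numberField E
  rw [heisHaar_image_prod]
  refine ENNReal.mul_lt_top ?_ (measure_traceZeroFundamentalDomain_lt_top hc μY)
  exact (measure_mono subset_closure).trans_lt (isCompact_closure_adeleFundamentalDomain (K := E)).measure_lt_top

/-- **THE `Ω_N`-INTEGRAL OF THE CLASS TAIL** at the central class: `tail_T(n y) = tail_T(y)` (★ FILE 1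
`kernelBorelTailClass_unipotent_mul_central`), so `∫_{n ∈ Ω_N} tail_T(n y) ∂heisHaar = (μX(D_E) μY(𝓕⁻)) · tail_T(y)` and the integrand is
integrable on `Ω_N`. [cite: Rogawski1990, §7.3 (p. 97)] -/
theorem integrableOn_and_setIntegral_heisHaar_kernelBorelTailClass_eq {cl : (quasiSplit F E c 3).arithmeticSubgroup → ι}
    (ν : Measure (adelicUnipotent F E c 3)) [ν.IsHaarMeasure]
    {𝓕 : Set (adelicUnipotent F E c 3)} (h𝓕 : IsFundamentalDomain (rationalUnipotent F E c 3) 𝓕 ν)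
    (hclN : IsUnipotentInvariantOnBorel F E c 3 cl) {i : ι}
    (hcl : ∀ γ : (quasiSplit F E c 3).arithmeticSubgroup, cl γ = i ↔
      ((adelicVal F E c 3 _ (γ : (quasiSplit F E c 3).Adelic) : GL (Fin 3) (AdeleRing (𝓞 E) E)) :
          Matrix (Fin 3) (Fin 3) (AdeleRing (𝓞 E) E)).charpoly =
        ((X - C ((ζ : Eˣ) : E)) ^ 3).map (algebraMap E (AdeleRing (𝓞 E) E)))
    {f : (quasiSplit F E c 3).Adelic → ℂ} (hfc : Continuous f) (hf : HasCompactSupport f) (T : ℝ≥0) (y : (quasiSplit F E c 3).Adelic) :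
    IntegrableOn (fun n : unipotentInBorel F E c 3 =>
        kernelBorelTailClass ν 𝓕 T cl i f (((n : borelAdelic F E c 3) : (quasiSplit F E c 3).Adelic) * y))
      (heisHomeomorph hc '' (adeleFundamentalDomain E ×ˢ traceZeroFundamentalDomain F E c)) (heisHaar hc μX μY) ∧
    ∫ n in heisHomeomorph hc '' (adeleFundamentalDomain E ×ˢ traceZeroFundamentalDomain F E c),
        kernelBorelTailClass ν 𝓕 T cl i f (((n : borelAdelic F E c 3) : (quasiSplit F E c 3).Adelic) * y) ∂(heisHaar hc μX μY) =
      (μX (adeleFundamentalDomain E) * μY (traceZeroFundamentalDomain F E c)).toReal • kernelBorelTailClass ν 𝓕 T cl i f y := by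
  have hτ : ∀ n : (quasiSplit F E c 3).Adelic, n ∈ adelicUnipotent F E c 3 → ∀ y' : (quasiSplit F E c 3).Adelic,
      kernelBorelTailClass ν 𝓕 T cl i f (n * y') = kernelBorelTailClass ν 𝓕 T cl i f y' :=
    fun n hn y' => kernelBorelTailClass_unipotent_mul_central hc ν h𝓕 hclN ζ hcl hfc hf T hn y'
  refine ⟨?_, setIntegral_heisHaar_image_prod_of_unipotent_mul_eq hc μX μY hτ _ _ y⟩
  have hfun : (fun n : unipotentInBorel F E c 3 =>
      kernelBorelTailClass ν 𝓕 T cl i f (((n : borelAdelic F E c 3) : (quasiSplit F E c 3).Adelic) * y)) =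
      fun _ => kernelBorelTailClass ν 𝓕 T cl i f y :=
    funext fun n => hτ _ ((unipToBorel F E c).symm n).2 y
  rw [hfun]
  exact integrableOn_const (heisHaar_image_fundamentalDomain_lt_top hc μX μY).ne

/-- **THE INNER INTEGRAL OF THE HEISENBERG BRACKET `ψʳ_T`** (the `hE`-input of the (F) assembly, inner `n`-integral): for every `y ∈ G(𝔸_F)`,
`ψʳ_T(n y) = Σ'_{ξ ∈ E^×} Σ'_{w ∈ E⁻} f((n y)⁻¹ (z₁ u(ξ, w)) (n y)) − tail_T(n y)` is integrable on `Ω_N` and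

  `∫_{n ∈ Ω_N} ψʳ_T(n y) ∂heisHaar = μX(D_E) · Σ'_{ξ ∈ E^×} ∫_{𝔸_E⁻} f(y⁻¹ (z₁ u(ξ, y')) y) dμY(y') − (μX(D_E) μY(𝓕⁻)) · tail_T(y)`

(§3 + the tail; no torus structure of `y` is used — the (E) assembly specialises `y := t k`). [cite: Rogawski1990, §7.3 Prop. 7.3.2 (p. 97)] -/
theorem integrableOn_and_setIntegral_heisHaar_heisBracket_eq {cl : (quasiSplit F E c 3).arithmeticSubgroup → ι} (hc1 : c ≠ 1)
    (hz₁ : (z₁ : (quasiSplit F E c 3).Adelic) =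
      (quasiSplit F E c 3).toAdelic (ratCenter F E c 3 ((StdForm.antidiagonal 3).over E) ζ))
    (ν : Measure (adelicUnipotent F E c 3)) [ν.IsHaarMeasure]
    {𝓕 : Set (adelicUnipotent F E c 3)} (h𝓕 : IsFundamentalDomain (rationalUnipotent F E c 3) 𝓕 ν)
    (hclN : IsUnipotentInvariantOnBorel F E c 3 cl) {i : ι}
    (hcl : ∀ γ : (quasiSplit F E c 3).arithmeticSubgroup, cl γ = i ↔
      ((adelicVal F E c 3 _ (γ : (quasiSplit F E c 3).Adelic) : GL (Fin 3) (AdeleRing (𝓞 E) E)) :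
          Matrix (Fin 3) (Fin 3) (AdeleRing (𝓞 E) E)).charpoly =
        ((X - C ((ζ : Eˣ) : E)) ^ 3).map (algebraMap E (AdeleRing (𝓞 E) E)))
    {f : (quasiSplit F E c 3).Adelic → ℂ} (hfc : Continuous f) (hf : HasCompactSupport f) (T : ℝ≥0) (y : (quasiSplit F E c 3).Adelic) :
    IntegrableOn (fun n : unipotentInBorel F E c 3 =>
        (∑' ξ : {ξ : E // ξ ≠ 0}, ∑' w : rationalTraceZero F E c,
          f ((((n : borelAdelic F E c 3) : (quasiSplit F E c 3).Adelic) * y)⁻¹ *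
            ((z₁ : (quasiSplit F E c 3).Adelic) *
              (((heisChart hc (algebraMap E (AdeleRing (𝓞 E) E) (ξ : E), (w : traceZeroAdele F E c))) :
                adelicUnipotent F E c 3) : (quasiSplit F E c 3).Adelic)) *
            (((n : borelAdelic F E c 3) : (quasiSplit F E c 3).Adelic) * y))) -
        kernelBorelTailClass ν 𝓕 T cl i f (((n : borelAdelic F E c 3) : (quasiSplit F E c 3).Adelic) * y))
      (heisHomeomorph hc '' (adeleFundamentalDomain E ×ˢ traceZeroFundamentalDomain F E c)) (heisHaar hc μX μY) ∧
    ∫ n in heisHomeomorph hc '' (adeleFundamentalDomain E ×ˢ traceZeroFundamentalDomain F E c),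
        ((∑' ξ : {ξ : E // ξ ≠ 0}, ∑' w : rationalTraceZero F E c,
          f ((((n : borelAdelic F E c 3) : (quasiSplit F E c 3).Adelic) * y)⁻¹ *
            ((z₁ : (quasiSplit F E c 3).Adelic) *
              (((heisChart hc (algebraMap E (AdeleRing (𝓞 E) E) (ξ : E), (w : traceZeroAdele F E c))) :
                adelicUnipotent F E c 3) : (quasiSplit F E c 3).Adelic)) *
            (((n : borelAdelic F E c 3) : (quasiSplit F E c 3).Adelic) * y))) -
        kernelBorelTailClass ν 𝓕 T cl i f (((n : borelAdelic F E c 3) : (quasiSplit F E c 3).Adelic) * y)) ∂(heisHaar hc μX μY) =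
      ((μX.real (adeleFundamentalDomain E) : ℝ) : ℂ) *
          (∑' ξ : {ξ : E // ξ ≠ 0}, ∫ y' : traceZeroAdele F E c,
            f (y⁻¹ * ((z₁ : (quasiSplit F E c 3).Adelic) *
              (((heisChart hc (algebraMap E (AdeleRing (𝓞 E) E) (ξ : E), y')) : adelicUnipotent F E c 3) :
                (quasiSplit F E c 3).Adelic)) * y) ∂μY) -
        (μX (adeleFundamentalDomain E) * μY (traceZeroFundamentalDomain F E c)).toReal • kernelBorelTailClass ν 𝓕 T cl i f y := by
  obtain ⟨hAi, hAv⟩ := integrableOn_and_setIntegral_heisHaar_heisPart_eq ζ hc μX μY hc1 hz₁ hfc hf y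
  obtain ⟨hBi, hBv⟩ := integrableOn_and_setIntegral_heisHaar_kernelBorelTailClass_eq ζ hc μX μY ν h𝓕 hclN hcl hfc hf T y
  refine ⟨hAi.sub hBi, ?_⟩
  rw [integral_sub hAi hBi, hAv, hBv]

end Bracket

end UnitaryGroup

end Literature.NumberTheory.Automorphic

end
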